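import Summits.Ventures.CertifiedManyBodySolver.Downfold.OneBandInPlaneFormDefect
import Summits.Ventures.CertifiedManyBodySolver.Downfold.OneBandCellTree
import HarnessLib

/-!
# The direct one-band in-plane band, VIII: nodal and antinodal Fermi points, velocities and the `t–t′` form defect
# under LINE monotonicity only (diagonal / zone face), composed with the cell-tree Fermi bracket

Venture CertifiedManyBodySolver, cell `pub/hubbard-downfold` (stage S1, technique B; INFL-3to1-B), seat hubbard-downfold-mod-4
(g25); namespace `Summit.Ventures.CertifiedManyBodySolver.Downfold.Emery`. Everything PROVED; no number lives here. WHAT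
THIS IS NOT: a statement about any material; `U = 0` one-body kinematics.

`OneBandInPlaneFermiPoints` / `OneBandInPlaneFormDefect` (g23) locate the nodal and antinodal Fermi crossings and certify
the velocity windows and the `t–t′` form defect under the SQUARE monotonicity `IpAnti` (band decreasing in `cos kx` AND
`cos ky` on `[−1, 1]²`), which fails for the extended-saddle class (Bi-2212, NCCO, SLCO legs). Only monotonicity ALONG THE
TWO LINES is needed for the brackets, and the Fermi-energy bracket now comes from the premise-free cell trees:

* §1 `DiagAnti S` / `FaceAnti S` (the band restricted to the zone diagonal / zone face is antitone in the cosine) from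
  one-variable kd certificates of `∂_u ε(u, u) ≤ 0` / `∂_v ε(−1, v) ≤ 0` (`diagAnti_of_kdCheck`, `faceAnti_of_kdCheck`);
* §2 bracket membership and existence of the nodal / face Fermi point under line monotonicity
  (`node_cos_mem_Ioo'`, `face_cos_mem_Ioo'`, `node_exists'`, `face_exists'`);
* §3 POINTWISE windows given a Fermi-energy bracket `ε ∈ [e₁, e₂]` from any device (`ipNode_of_lineChecks`,
  `ipFace_of_lineChecks`, `ipForm_of_lineChecks`), and the compositions with the cell-tree bracket
  `fermi_mem_Icc_of_treeBracket` (`ipNodeT_of_checks`, `ipFaceT_of_checks`, `ipFormT_of_checks`, `ipNodeFaceT_exist`).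

Sources: `t–t′(–t″)` form [AndersenEtAl1995, §6]; interval/subdivision verification [Moore1966, Theorem 3.1, §4.4].
-/

noncomputable section

namespace Summit.Ventures.CertifiedManyBodySolver.Downfold.Emery

open Real Set Literature.Analysis.ValidatedNumerics

/-! ## §1 Line monotonicity from one-variable kd certificates -/

/-- The band on the zone DIAGONAL is antitone in `u = cos k` on `[−1, 1]`. [folklore] -/
def DiagAnti (S : List (ℕ × ℕ × ℚ)) : Prop := AntitoneOn (ipDiag S) (Icc (-1 : ℝ) 1)

/-- The band on the zone FACE `kx = π` is antitone in `v = cos ky` on `[−1, 1]`. [folklore] -/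
def FaceAnti (S : List (ℕ × ℕ × ℚ)) : Prop := AntitoneOn (ipFace S) (Icc (-1 : ℝ) 1)

/-- `IpAnti` implies both line monotonicities. [folklore] -/
theorem diagAnti_of_ipAnti {S : List (ℕ × ℕ × ℚ)} (hA : IpAnti S) : DiagAnti S :=
  fun _ hu _ hu' h => hA hu hu hu' hu' h h

/-- [folklore] -/
theorem faceAnti_of_ipAnti {S : List (ℕ × ℕ × ℚ)} (hA : IpAnti S) : FaceAnti S :=
  fun _ hv _ hv' h => hA (by norm_num) hv (by norm_num) hv' le_rfl h

/-- Derivative of `T_m(u)·T_n(u)`-type diagonal stars: `d/du star(u, u) = 2·dstarU(u, u)`. [folklore] -/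
theorem hasDerivAt_starUV_diag (m n : ℕ) (u : ℝ) :
    HasDerivAt (fun u => starUV m n u u) (2 * dstarU m n u u) u := by
  unfold starUV dstarU
  by_cases hn : n = 0
  · by_cases hm : m = 0
    · simp only [hn, hm, if_true]; simpa using hasDerivAt_const u (1 : ℝ)
    · simp only [hn, hm, if_true, if_false]
      have h := ((hasDerivAt_cheb m u).add (hasDerivAt_cheb m u)).const_mul 2
      exact h.congr_deriv (by ring)
  · by_cases hmn : m = n
    · simp only [hn, hmn, if_true, if_false]
      have h := ((hasDerivAt_cheb n u).mul (hasDerivAt_cheb n u)).const_mul 4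
      exact h.congr_deriv (by ring)
    · simp only [hn, hmn, if_false]
      have h := (((hasDerivAt_cheb m u).mul (hasDerivAt_cheb n u)).add
        ((hasDerivAt_cheb n u).mul (hasDerivAt_cheb m u))).const_mul 4
      exact h.congr_deriv (by ring)

/-- `d/du ε(u, u) = 2·∂_u ε(u, u)`. [folklore] -/
theorem hasDerivAt_ipDiag (S : List (ℕ × ℕ × ℚ)) (u : ℝ) : HasDerivAt (ipDiag S) (2 * ipBandU S u u) u := by
  unfold ipDiag
  induction S with
  | nil => simp only [ipBandUV, ipBandU, List.map_nil, List.sum_nil, mul_zero]; exact hasDerivAt_const u (0 : ℝ)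
  | cons s S ih =>
    simp only [ipBandUV, ipBandU, List.map_cons, List.sum_cons] at ih ⊢
    have h := ((hasDerivAt_starUV_diag s.1 s.2.1 u).const_mul (s.2.2 : ℝ)).add ih
    exact h.congr_deriv (by ring)

/-- `d/dv ε(−1, v) = ∂_u ε(v, −1)`. [folklore] -/
theorem hasDerivAt_ipFace (S : List (ℕ × ℕ × ℚ)) (v : ℝ) : HasDerivAt (ipFace S) (ipBandU S v (-1)) v := by
  unfold ipFace; exact hasDerivAt_ipBandUV_v S (-1) v

/-- One-variable kd certificate of `∂_u ε(u, u) ≤ 0` on `[−1, 1]`. [cite: Moore1966, Theorem 3.1, §4.4] -/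
def ipDiagMonoCheck (S : List (ℕ × ℕ × ℚ)) (t : KdCert ℕ) : Bool :=
  t.check (exprLeOn (ipBandUGE S (.var 0) (.var 0)) 0) [(-1, 1)]

/-- One-variable kd certificate of `∂_v ε(−1, v) ≤ 0` on `[−1, 1]`. [cite: Moore1966, Theorem 3.1, §4.4] -/
def ipFaceMonoCheck (S : List (ℕ × ℕ × ℚ)) (t : KdCert ℕ) : Bool :=
  t.check (exprLeOn (ipBandUGE S (.var 0) (.const (-1))) 0) [(-1, 1)]

/-- [folklore] -/
theorem box_mem₁ {lo hi : ℚ} {u : ℝ} (hu : u ∈ Icc (lo : ℝ) hi) : Box.mem [(lo, hi)] (fun i => if i = 0 then u else 0) := by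
  intro i
  match i with
  | 0 => simpa [Box.ivl] using hu
  | k + 1 => simp [Box.ivl]

/-- **`DiagAnti` from a passing certificate.** [cite: Moore1966, Theorem 3.1, §4.4] -/
theorem diagAnti_of_kdCheck {S : List (ℕ × ℕ × ℚ)} {t : KdCert ℕ} (h : ipDiagMonoCheck S t = true) : DiagAnti S := by
  have hd : ∀ u ∈ Icc (-1 : ℝ) 1, ipBandU S u u ≤ 0 := by
    intro u hu
    have hu' : u ∈ Icc (((-1 : ℚ) : ℚ) : ℝ) ((1 : ℚ) : ℝ) := by simpa using hu
    have := eval_le_of_kdCheck h _ (box_mem₁ hu')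
    simpa [eval_ipBandUGE] using this
  refine antitoneOn_of_deriv_nonpos (convex_Icc _ _) (continuous_ipDiag S).continuousOn ?_ ?_
  · exact fun u _ => (hasDerivAt_ipDiag S u).differentiableAt.differentiableWithinAt
  · intro u hu
    rw [interior_Icc] at hu
    rw [(hasDerivAt_ipDiag S u).deriv]
    have := hd u (Ioo_subset_Icc_self hu)
    linarith

/-- **`FaceAnti` from a passing certificate.** [cite: Moore1966, Theorem 3.1, §4.4] -/
theorem faceAnti_of_kdCheck {S : List (ℕ × ℕ × ℚ)} {t : KdCert ℕ} (h : ipFaceMonoCheck S t = true) : FaceAnti S := by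
  have hd : ∀ v ∈ Icc (-1 : ℝ) 1, ipBandU S v (-1) ≤ 0 := by
    intro v hv
    have hv' : v ∈ Icc (((-1 : ℚ) : ℚ) : ℝ) ((1 : ℚ) : ℝ) := by simpa using hv
    have := eval_le_of_kdCheck h _ (box_mem₁ hv')
    simpa [eval_ipBandUGE] using this
  refine antitoneOn_of_deriv_nonpos (convex_Icc _ _) (continuous_ipFace S).continuousOn ?_ ?_
  · exact fun v _ => (hasDerivAt_ipFace S v).differentiableAt.differentiableWithinAt
  · intro v hv
    rw [interior_Icc] at hv
    rw [(hasDerivAt_ipFace S v).deriv]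
    exact hd v (Ioo_subset_Icc_self hv)

/-! ## §2 Brackets under line monotonicity -/

/-- Every diagonal Fermi point lies in the node bracket (line monotonicity only). [folklore] -/
theorem node_cos_mem_Ioo' {S : List (ℕ × ℕ × ℚ)} (hD : DiagAnti S) {e₁ e₂ ua ub : ℚ}
    (h : ipNodeBracketCheck S e₁ e₂ ua ub = true) {ε : ℝ} (hε : ε ∈ Icc (e₁ : ℝ) e₂)
    {u : ℝ} (hu : u ∈ Icc (-1 : ℝ) 1) (hF : ipDiag S u = ε) : u ∈ Ioo (ua : ℝ) ub := by
  simp only [ipNodeBracketCheck, Bool.and_eq_true, decide_eq_true_eq] at h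
  obtain ⟨⟨⟨⟨ha, hab⟩, hb⟩, hhi⟩, hlo⟩ := h
  have ha' : (-1 : ℝ) ≤ ua := by exact_mod_cast ha
  have hb' : (ub : ℝ) ≤ 1 := by exact_mod_cast hb
  have hab' : (ua : ℝ) < ub := by exact_mod_cast hab
  have hhi' := (Rat.cast_lt (K := ℝ)).2 hhi
  have hlo' := (Rat.cast_lt (K := ℝ)).2 hlo
  rw [cast_ipBandQ] at hhi' hlo'
  have hua : (ua : ℝ) ∈ Icc (-1 : ℝ) 1 := ⟨ha', hab'.le.trans hb'⟩
  have hub : (ub : ℝ) ∈ Icc (-1 : ℝ) 1 := ⟨ha'.trans hab'.le, hb'⟩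
  constructor
  · by_contra hle
    have := hD hu hua (not_lt.1 hle)
    unfold ipDiag at this hF; linarith [hε.2]
  · by_contra hle
    have := hD hub hu (not_lt.1 hle)
    unfold ipDiag at this hF; linarith [hε.1]

/-- Every face Fermi point lies in the face bracket (line monotonicity only). [folklore] -/
theorem face_cos_mem_Ioo' {S : List (ℕ × ℕ × ℚ)} (hFa : FaceAnti S) {e₁ e₂ va vb : ℚ}
    (h : ipFaceBracketCheck S e₁ e₂ va vb = true) {ε : ℝ} (hε : ε ∈ Icc (e₁ : ℝ) e₂)
    {v : ℝ} (hv : v ∈ Icc (-1 : ℝ) 1) (hF : ipFace S v = ε) : v ∈ Ioo (va : ℝ) vb := by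
  simp only [ipFaceBracketCheck, Bool.and_eq_true, decide_eq_true_eq] at h
  obtain ⟨⟨⟨⟨ha, hab⟩, hb⟩, hhi⟩, hlo⟩ := h
  have ha' : (-1 : ℝ) ≤ va := by exact_mod_cast ha
  have hb' : (vb : ℝ) ≤ 1 := by exact_mod_cast hb
  have hab' : (va : ℝ) < vb := by exact_mod_cast hab
  have hhi' := (Rat.cast_lt (K := ℝ)).2 hhi
  have hlo' := (Rat.cast_lt (K := ℝ)).2 hlo
  rw [cast_ipBandQ] at hhi' hlo'
  push_cast at hhi' hlo'
  have hva : (va : ℝ) ∈ Icc (-1 : ℝ) 1 := ⟨ha', hab'.le.trans hb'⟩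
  have hvb : (vb : ℝ) ∈ Icc (-1 : ℝ) 1 := ⟨ha'.trans hab'.le, hb'⟩
  constructor
  · by_contra hle
    have := hFa hv hva (not_lt.1 hle)
    unfold ipFace at this hF; linarith [hε.2]
  · by_contra hle
    have := hFa hvb hv (not_lt.1 hle)
    unfold ipFace at this hF; linarith [hε.1]

/-- A nodal Fermi point EXISTS (intermediate value theorem; no monotonicity needed for existence). [folklore] -/
theorem node_exists' {S : List (ℕ × ℕ × ℚ)} {e₁ e₂ ua ub : ℚ}
    (h : ipNodeBracketCheck S e₁ e₂ ua ub = true) {ε : ℝ} (hε : ε ∈ Icc (e₁ : ℝ) e₂) :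
    ∃ u ∈ Icc (ua : ℝ) ub, ipDiag S u = ε := by
  simp only [ipNodeBracketCheck, Bool.and_eq_true, decide_eq_true_eq] at h
  obtain ⟨⟨⟨⟨-, hab⟩, -⟩, hhi⟩, hlo⟩ := h
  have hhi' := (Rat.cast_lt (K := ℝ)).2 hhi
  have hlo' := (Rat.cast_lt (K := ℝ)).2 hlo
  rw [cast_ipBandQ] at hhi' hlo'
  have hab' : (ua : ℝ) ≤ ub := by exact_mod_cast hab.le
  have hsub := intermediate_value_Icc' hab' (continuous_ipDiag S).continuousOn
  exact hsub ⟨by unfold ipDiag; linarith [hε.1], by unfold ipDiag; linarith [hε.2]⟩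

/-- An antinodal (face) Fermi point EXISTS. [folklore] -/
theorem face_exists' {S : List (ℕ × ℕ × ℚ)} {e₁ e₂ va vb : ℚ}
    (h : ipFaceBracketCheck S e₁ e₂ va vb = true) {ε : ℝ} (hε : ε ∈ Icc (e₁ : ℝ) e₂) :
    ∃ v ∈ Icc (va : ℝ) vb, ipFace S v = ε := by
  simp only [ipFaceBracketCheck, Bool.and_eq_true, decide_eq_true_eq] at h
  obtain ⟨⟨⟨⟨-, hab⟩, -⟩, hhi⟩, hlo⟩ := h
  have hhi' := (Rat.cast_lt (K := ℝ)).2 hhi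
  have hlo' := (Rat.cast_lt (K := ℝ)).2 hlo
  rw [cast_ipBandQ] at hhi' hlo'
  push_cast at hhi' hlo'
  have hab' : (va : ℝ) ≤ vb := by exact_mod_cast hab.le
  have hsub := intermediate_value_Icc' hab' (continuous_ipFace S).continuousOn
  exact hsub ⟨by unfold ipFace; linarith [hε.1], by unfold ipFace; linarith [hε.2]⟩


/-! ## §3 Pointwise windows and the compositions with the cell-tree Fermi bracket -/

/-- **NODAL POINT, pointwise**: given `ε ∈ [e₁, e₂]`, a node bracket, a velocity window on it and `DiagAnti`, every diagonal
Fermi momentum has `cos k ∈ (ua, ub)` and `|∇ε|²(k, k) ∈ [w_lo, w_hi]`. [folklore] -/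
theorem ipNode_of_lineChecks {S : List (ℕ × ℕ × ℚ)} (hD : DiagAnti S) {e₁ e₂ ua ub wlo whi : ℚ} {t₁ t₂ : KdCert ℕ}
    (hnb : ipNodeBracketCheck S e₁ e₂ ua ub = true) (hw : windowCheck₁ (ipNodeGradSqE S) ua ub wlo whi t₁ t₂ = true)
    {ε : ℝ} (hε : ε ∈ Icc (e₁ : ℝ) e₂) {k : ℝ} (hS : shellsOK S = true) (hF : ipBandK S k k = ε) :
    cos k ∈ Ioo (ua : ℝ) ub ∧ ipGradSq S k k ∈ Icc (wlo : ℝ) whi := by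
  rw [ipBandK_diag hS] at hF
  have hu := node_cos_mem_Ioo' hD hnb hε ⟨neg_one_le_cos k, cos_le_one k⟩ hF
  refine ⟨hu, ?_⟩
  have hwin := window_of_check₁ hw (Ioo_subset_Icc_self hu)
  rw [eval_ipNodeGradSqE] at hwin
  simpa [ipGradSq_eq_UV] using hwin

/-- **ANTINODAL (FACE) POINT, pointwise.** [folklore] -/
theorem ipFace_of_lineChecks {S : List (ℕ × ℕ × ℚ)} (hFa : FaceAnti S) {e₁ e₂ va vb wlo whi : ℚ} {t₁ t₂ : KdCert ℕ}
    (hfb : ipFaceBracketCheck S e₁ e₂ va vb = true) (hw : windowCheck₁ (ipFaceGradSqE S) va vb wlo whi t₁ t₂ = true)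
    {ε : ℝ} (hε : ε ∈ Icc (e₁ : ℝ) e₂) {k : ℝ} (hS : shellsOK S = true) (hF : ipBandK S π k = ε) :
    cos k ∈ Ioo (va : ℝ) vb ∧ ipGradSq S π k ∈ Icc (wlo : ℝ) whi := by
  rw [ipBandK_face hS] at hF
  have hv := face_cos_mem_Ioo' hFa hfb hε ⟨neg_one_le_cos k, cos_le_one k⟩ hF
  refine ⟨hv, ?_⟩
  have hwin := window_of_check₁ hw (Ioo_subset_Icc_self hv)
  rw [eval_ipFaceGradSqE] at hwin
  simpa [ipGradSq_eq_UV, cos_pi] using hwin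

/-- **THE FORM THEOREM, pointwise**: the `t–t′` contour through the nodal and antinodal Fermi points, the matched scales
`t_node`, `t_an` and the form defect `δ`, from the eight kd claims on the bracket box, given `cos kn ∈ [ua, ub]` and
`cos ka ∈ [va, vb]` (from any bracket device). [folklore] -/
theorem ipForm_of_windows {S : List (ℕ × ℕ × ℚ)} {ua ub va vb tnlo tnhi talo tahi δ η : ℚ}
    {t0 t1 t2 t3 t4 t5 t6 t7 : KdCert ℕ}
    (hsg : formSignCheck tnlo tnhi talo tahi δ η = true)
    (h0 : t0.check (exprLeOn (fcRhoD η) 0) [(ua, ub), (va, vb)] = true)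
    (h1 : t1.check (exprLeOn (fcNodePos η) 0) [(ua, ub), (va, vb)] = true)
    (h2 : t2.check (exprLeOn (fcFacePos η) 0) [(ua, ub), (va, vb)] = true)
    (h3 : t3.check (exprLeOn (fcNodeLo S tnlo) 0) [(ua, ub), (va, vb)] = true)
    (h4 : t4.check (exprLeOn (fcNodeHi S tnhi) 0) [(ua, ub), (va, vb)] = true)
    (h5 : t5.check (exprLeOn (fcFaceLo S talo) 0) [(ua, ub), (va, vb)] = true)
    (h6 : t6.check (exprLeOn (fcFaceHi S tahi) 0) [(ua, ub), (va, vb)] = true)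
    (h7 : t7.check (exprLeOn (fcDefect S δ) 0) [(ua, ub), (va, vb)] = true)
    {kn ka : ℝ} (hu : cos kn ∈ Icc (ua : ℝ) ub) (hv : cos ka ∈ Icc (va : ℝ) vb) :
    oneBand 0 1 (ttpRho (cos kn) (cos ka)) 0 kn kn = oneBand 0 1 (ttpRho (cos kn) (cos ka)) 0 π ka ∧
    (∀ t : ℝ, 0 ≤ t → t ^ 2 * ttpGradSqUV (ttpRho (cos kn) (cos ka)) (cos kn) (cos kn) = ipGradSq S kn kn →
      t ∈ Icc (tnlo : ℝ) tnhi) ∧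
    (∀ t : ℝ, 0 ≤ t → t ^ 2 * ttpGradSqUV (ttpRho (cos kn) (cos ka)) (-1) (cos ka) = ipGradSq S π ka →
      t ∈ Icc (talo : ℝ) tahi) ∧
    (1 + (δ : ℝ)) ^ 2 * (ttpGradSqUV (ttpRho (cos kn) (cos ka)) (cos kn) (cos kn) * ipGradSq S π ka) ≤
      ttpGradSqUV (ttpRho (cos kn) (cos ka)) (-1) (cos ka) * ipGradSq S kn kn := by
  rw [ipGradSq_eq_UV, ipGradSq_eq_UV, cos_pi]
  set u := cos kn with hu_def
  set v := cos ka with hv_def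
  simp only [formSignCheck, Bool.and_eq_true, decide_eq_true_eq] at hsg
  obtain ⟨⟨⟨⟨⟨hη, htnlo⟩, htnhi⟩, htalo⟩, htahi⟩, hδ⟩ := hsg
  have c0 := eval_pt₂_le_of_kdCheck h0 hu hv
  have c1 := eval_pt₂_le_of_kdCheck h1 hu hv
  have c2 := eval_pt₂_le_of_kdCheck h2 hu hv
  have c3 := eval_pt₂_le_of_kdCheck h3 hu hv
  have c4 := eval_pt₂_le_of_kdCheck h4 hu hv
  have c5 := eval_pt₂_le_of_kdCheck h5 hu hv
  have c6 := eval_pt₂_le_of_kdCheck h6 hu hv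
  have c7 := eval_pt₂_le_of_kdCheck h7 hu hv
  simp only [fcRhoD, fcNodePos, fcFacePos, fcNodeLo, fcNodeHi, fcFaceLo, fcFaceHi, fcDefect,
    ArithExpr.eval_sub, ArithExpr.eval_mul, ArithExpr.eval_const, eval_rhoDE, eval_nodeFormNE,
    eval_faceFormNE, eval_ipNodeGradSqE, eval_ipFaceGradSqE₁, pt₂_zero, pt₂_one, Rat.cast_pow, Rat.cast_add,
    Rat.cast_one, Rat.cast_zero] at c0 c1 c2 c3 c4 c5 c6 c7
  have hη' : (0 : ℝ) < η := by exact_mod_cast hη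
  have hD : 0 < rhoD u v := by linarith
  have hDne : rhoD u v ≠ 0 := hD.ne'
  have hNf : 0 < nodeFormN u v := by linarith
  have hFf : 0 < faceFormN u v := by linarith
  have hGn : ttpGradSqUV (ttpRho u v) u u = nodeFormN u v / rhoD u v ^ 2 := by
    rw [← nodeFormN_eq hDne]; field_simp
  have hGf : ttpGradSqUV (ttpRho u v) (-1) v = faceFormN u v / rhoD u v ^ 2 := by
    rw [← faceFormN_eq hDne]; field_simp
  have hD2 : 0 < rhoD u v ^ 2 := by positivity
  refine ⟨?_, ?_, ?_, ?_⟩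
  · rw [← ttpUV_eq_oneBand, ← ttpUV_eq_oneBand, cos_pi]
    exact ttpRho_contour hDne
  · intro t ht hmatch
    rw [hGn] at hmatch
    have key : t ^ 2 * nodeFormN u v = rhoD u v ^ 2 * ipGradSqUV S u u := by
      rw [← hmatch]; field_simp
    have htnlo' : (0 : ℝ) ≤ tnlo := by exact_mod_cast htnlo
    have htnhi' : (0 : ℝ) ≤ tnhi := by exact_mod_cast htnhi
    constructor
    · refine le_of_sq_le_sq' ?_ htnlo' ht
      exact le_of_mul_le_mul_right (by linarith) hNf
    · refine le_of_sq_le_sq' ?_ ht htnhi'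
      exact le_of_mul_le_mul_right (by linarith) hNf
  · intro t ht hmatch
    rw [hGf] at hmatch
    have key : t ^ 2 * faceFormN u v = rhoD u v ^ 2 * ipGradSqUV S (-1) v := by
      rw [← hmatch]; field_simp
    have htalo' : (0 : ℝ) ≤ talo := by exact_mod_cast htalo
    have htahi' : (0 : ℝ) ≤ tahi := by exact_mod_cast htahi
    constructor
    · refine le_of_sq_le_sq' ?_ htalo' ht
      exact le_of_mul_le_mul_right (by linarith) hFf
    · refine le_of_sq_le_sq' ?_ ht htahi'
      exact le_of_mul_le_mul_right (by linarith) hFf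
  · rw [hGn, hGf]
    rw [show (1 + (δ : ℝ)) ^ 2 * (nodeFormN u v / rhoD u v ^ 2 * ipGradSqUV S (-1) v) =
        ((1 + (δ : ℝ)) ^ 2 * nodeFormN u v * ipGradSqUV S (-1) v) / rhoD u v ^ 2 by field_simp]
    rw [show faceFormN u v / rhoD u v ^ 2 * ipGradSqUV S u u = (faceFormN u v * ipGradSqUV S u u) / rhoD u v ^ 2 by
        field_simp]
    exact div_le_div_of_nonneg_right (by linarith) hD2.le

/-- **The form theorem under LINE monotonicity**, given a Fermi-energy bracket `ε ∈ [e₁, e₂]` from any device.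
[folklore] -/
theorem ipForm_of_lineChecks {S : List (ℕ × ℕ × ℚ)} (hS : shellsOK S = true) (hD : DiagAnti S) (hFa : FaceAnti S)
    {e₁ e₂ ua ub va vb tnlo tnhi talo tahi δ η : ℚ} {t0 t1 t2 t3 t4 t5 t6 t7 : KdCert ℕ}
    (hnb : ipNodeBracketCheck S e₁ e₂ ua ub = true) (hfb : ipFaceBracketCheck S e₁ e₂ va vb = true)
    (hsg : formSignCheck tnlo tnhi talo tahi δ η = true)
    (h0 : t0.check (exprLeOn (fcRhoD η) 0) [(ua, ub), (va, vb)] = true)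
    (h1 : t1.check (exprLeOn (fcNodePos η) 0) [(ua, ub), (va, vb)] = true)
    (h2 : t2.check (exprLeOn (fcFacePos η) 0) [(ua, ub), (va, vb)] = true)
    (h3 : t3.check (exprLeOn (fcNodeLo S tnlo) 0) [(ua, ub), (va, vb)] = true)
    (h4 : t4.check (exprLeOn (fcNodeHi S tnhi) 0) [(ua, ub), (va, vb)] = true)
    (h5 : t5.check (exprLeOn (fcFaceLo S talo) 0) [(ua, ub), (va, vb)] = true)
    (h6 : t6.check (exprLeOn (fcFaceHi S tahi) 0) [(ua, ub), (va, vb)] = true)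
    (h7 : t7.check (exprLeOn (fcDefect S δ) 0) [(ua, ub), (va, vb)] = true)
    {ε : ℝ} (hε : ε ∈ Icc (e₁ : ℝ) e₂) {kn ka : ℝ} (hn : ipBandK S kn kn = ε) (ha : ipBandK S π ka = ε) :
    oneBand 0 1 (ttpRho (cos kn) (cos ka)) 0 kn kn = oneBand 0 1 (ttpRho (cos kn) (cos ka)) 0 π ka ∧
    (∀ t : ℝ, 0 ≤ t → t ^ 2 * ttpGradSqUV (ttpRho (cos kn) (cos ka)) (cos kn) (cos kn) = ipGradSq S kn kn →
      t ∈ Icc (tnlo : ℝ) tnhi) ∧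
    (∀ t : ℝ, 0 ≤ t → t ^ 2 * ttpGradSqUV (ttpRho (cos kn) (cos ka)) (-1) (cos ka) = ipGradSq S π ka →
      t ∈ Icc (talo : ℝ) tahi) ∧
    (1 + (δ : ℝ)) ^ 2 * (ttpGradSqUV (ttpRho (cos kn) (cos ka)) (cos kn) (cos kn) * ipGradSq S π ka) ≤
      ttpGradSqUV (ttpRho (cos kn) (cos ka)) (-1) (cos ka) * ipGradSq S kn kn := by
  rw [ipBandK_diag hS] at hn
  rw [ipBandK_face hS] at ha
  have hu := Ioo_subset_Icc_self (node_cos_mem_Ioo' hD hnb hε ⟨neg_one_le_cos kn, cos_le_one kn⟩ hn)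
  have hv := Ioo_subset_Icc_self (face_cos_mem_Ioo' hFa hfb hε ⟨neg_one_le_cos ka, cos_le_one ka⟩ ha)
  exact ipForm_of_windows hsg h0 h1 h2 h3 h4 h5 h6 h7 hu hv

/-- **Existence at a bracketed energy**: a nodal and an antinodal Fermi momentum in `[0, π]` exist. [folklore] -/
theorem ipNodeFace_exist' {S : List (ℕ × ℕ × ℚ)} (hS : shellsOK S = true) {e₁ e₂ ua ub va vb : ℚ}
    (hnb : ipNodeBracketCheck S e₁ e₂ ua ub = true) (hfb : ipFaceBracketCheck S e₁ e₂ va vb = true)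
    {ε : ℝ} (hε : ε ∈ Icc (e₁ : ℝ) e₂) :
    (∃ k ∈ Icc (0 : ℝ) π, ipBandK S k k = ε) ∧ (∃ k ∈ Icc (0 : ℝ) π, ipBandK S π k = ε) := by
  have hn := hnb; have hf := hfb
  simp only [ipNodeBracketCheck, ipFaceBracketCheck, Bool.and_eq_true, decide_eq_true_eq] at hn hf
  constructor
  · obtain ⟨u, hu, hfu⟩ := node_exists' hnb hε
    have hu1 : -1 ≤ u := le_trans (by exact_mod_cast hn.1.1.1.1) hu.1
    have hu2 : u ≤ 1 := hu.2.trans (by exact_mod_cast hn.1.1.2)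
    refine ⟨arccos u, ⟨arccos_nonneg u, arccos_le_pi u⟩, ?_⟩
    rw [ipBandK_diag hS, cos_arccos hu1 hu2]; exact hfu
  · obtain ⟨v, hv, hfv⟩ := face_exists' hfb hε
    have hv1 : -1 ≤ v := le_trans (by exact_mod_cast hf.1.1.1.1) hv.1
    have hv2 : v ≤ 1 := hv.2.trans (by exact_mod_cast hf.1.1.2)
    refine ⟨arccos v, ⟨arccos_nonneg v, arccos_le_pi v⟩, ?_⟩
    rw [ipBandK_face hS, cos_arccos hv1 hv2]; exact hfv

/-- **NODAL POINT with the cell-tree bracket (`K = 384`)**: for every Fermi energy `ε` with `ipFilling S ε ∈ [ν₁, ν₂]` and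
every diagonal Fermi momentum. [folklore] -/
theorem ipNodeT_of_checks {S : List (ℕ × ℕ × ℚ)} (hS : shellsOK S = true) {td : KdCert ℕ} (hd : ipDiagMonoCheck S td = true)
    {e₁ e₂ ν₁ ν₂ ua ub wlo whi : ℚ} {tr₁ tr₂ : CellTree} {t₁ t₂ : KdCert ℕ}
    (h₁ : treeCheck 384 cosLo384T.get cosHi384T.get S e₁ tr₁ = true)
    (h₂ : treeCheck 384 cosLo384T.get cosHi384T.get S e₂ tr₂ = true)
    (hs : treeBracketSides 384 e₁ e₂ ν₁ ν₂ (tr₁.kept 0 384 0 384) (tr₂.inner 0 384 0 384) = true)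
    (hnb : ipNodeBracketCheck S e₁ e₂ ua ub = true) (hw : windowCheck₁ (ipNodeGradSqE S) ua ub wlo whi t₁ t₂ = true)
    {ε : ℝ} (hν : ipFilling S ε ∈ Icc (ν₁ : ℝ) ν₂) {k : ℝ} (hF : ipBandK S k k = ε) :
    cos k ∈ Ioo (ua : ℝ) ub ∧ ipGradSq S k k ∈ Icc (wlo : ℝ) whi :=
  ipNode_of_lineChecks (diagAnti_of_kdCheck hd) hnb hw
    (fermi_mem_Icc_of_treeBracket (by norm_num) (by norm_num) cosEncl384 h₁ h₂ hs hν) hS hF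

/-- **ANTINODAL POINT with the cell-tree bracket (`K = 384`).** [folklore] -/
theorem ipFaceT_of_checks {S : List (ℕ × ℕ × ℚ)} (hS : shellsOK S = true) {tf : KdCert ℕ} (hf : ipFaceMonoCheck S tf = true)
    {e₁ e₂ ν₁ ν₂ va vb wlo whi : ℚ} {tr₁ tr₂ : CellTree} {t₁ t₂ : KdCert ℕ}
    (h₁ : treeCheck 384 cosLo384T.get cosHi384T.get S e₁ tr₁ = true)
    (h₂ : treeCheck 384 cosLo384T.get cosHi384T.get S e₂ tr₂ = true)
    (hs : treeBracketSides 384 e₁ e₂ ν₁ ν₂ (tr₁.kept 0 384 0 384) (tr₂.inner 0 384 0 384) = true)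
    (hfb : ipFaceBracketCheck S e₁ e₂ va vb = true) (hw : windowCheck₁ (ipFaceGradSqE S) va vb wlo whi t₁ t₂ = true)
    {ε : ℝ} (hν : ipFilling S ε ∈ Icc (ν₁ : ℝ) ν₂) {k : ℝ} (hF : ipBandK S π k = ε) :
    cos k ∈ Ioo (va : ℝ) vb ∧ ipGradSq S π k ∈ Icc (wlo : ℝ) whi :=
  ipFace_of_lineChecks (faceAnti_of_kdCheck hf) hfb hw
    (fermi_mem_Icc_of_treeBracket (by norm_num) (by norm_num) cosEncl384 h₁ h₂ hs hν) hS hF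

end Summit.Ventures.CertifiedManyBodySolver.Downfold.Emery
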